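import Literature.AlgebraicGeometry.Resolution.SmoothNormalizationConstants
import Mathlib.RingTheory.Smooth.Locus
import Mathlib.RingTheory.Localization.AtPrime.Basic
import Mathlib.RingTheory.Valuation.ValuationSubring
import HarnessLib

/-!
# Transport of smoothness at a prime along ring isomorphisms; units of valuation subrings

Topic: `Literature/AlgebraicGeometry/Resolution`. Bookkeeping used in the formalization of
Steps 3–4 of the proof of Thm. 4.1.1 of M. Temkin, *Inseparable local uniformization*
(arXiv:0804.1554v3, pp. 48–49), where the same affine model appears in several guises (as a
subring of one field, as Mathlib's `integralClosure`, as a subalgebra over isomorphic copies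
`l ≅ l′` of the ground field) and smoothness of a point has to be moved between them:

* `isSmoothAt_of_ringEquiv` — `Algebra.IsSmoothAt` is transported along a pair of compatible ring
  isomorphisms of base and algebra (the point being moved by the isomorphism);
* `mem_maximalIdeal_iff_of_comap_eq` — for an extension of valuation rings
  `O′ ∩ K = O` an element of `O` lies in `𝔪_O` iff its image lies in `𝔪_{O′}` (so centres of `O′`
  contract to centres of `O`); `mem_maximalIdeal_valuationSubring_iff_or` phrases membership in
  `𝔪_O` inside the field, so that such comparisons never ask the kernel to identify iterated
  `Subring.inclusion`s definitionally.

Everything here is folklore and PROVED (the base-change lemma `formallySmooth_of_ringEquiv_base`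
is the one of `SmoothNormalizationConstants.lean`).
-/

noncomputable section

namespace Literature.AlgebraicGeometry.Resolution

universe u v w

/-! ### Transport of `IsSmoothAt` along isomorphisms -/

section smoothAt

variable {R₁ R₂ A₁ A₂ : Type*} [CommRing R₁] [CommRing R₂] [CommRing A₁] [CommRing A₂]
  [Algebra R₁ A₁] [Algebra R₂ A₂]

/-- The complement of a prime is mapped by a ring isomorphism onto the complement of the
corresponding prime. [folklore] -/
theorem primeCompl_map_ringEquiv (eA : A₁ ≃+* A₂) (p₁ : Ideal A₁) (p₂ : Ideal A₂) [p₁.IsPrime]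
    [p₂.IsPrime] (hp : p₁ = p₂.comap eA.toRingHom) :
    p₁.primeCompl.map eA.toRingHom.toMonoidHom = p₂.primeCompl := by
  ext y
  constructor
  · rintro ⟨x, hx, rfl⟩
    intro hy
    exact hx (by rw [hp]; exact hy)
  · intro hy
    refine ⟨eA.symm y, fun hx => hy ?_, eA.apply_symm_apply y⟩
    rw [hp] at hx
    simpa using hx

/-- **Smoothness at a prime is transported along compatible isomorphisms of base and algebra**:
for `eR : R₁ ≃ R₂`, `eA : A₁ ≃ A₂` with `eA ∘ algebraMap = algebraMap ∘ eR`, and primes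
`p₁ = eA⁻¹(p₂)`, `A₁` is `R₁`-smooth at `p₁` iff `A₂` is `R₂`-smooth at `p₂` (the local rings
are isomorphic compatibly with the isomorphic bases). [folklore] -/
theorem isSmoothAt_of_ringEquiv (eR : R₁ ≃+* R₂) (eA : A₁ ≃+* A₂)
    (hcomm : ∀ r : R₁, eA (algebraMap R₁ A₁ r) = algebraMap R₂ A₂ (eR r))
    (p₁ : Ideal A₁) (p₂ : Ideal A₂) [p₁.IsPrime] [p₂.IsPrime] (hp : p₁ = p₂.comap eA.toRingHom)
    (h : Algebra.IsSmoothAt R₁ p₁) : Algebra.IsSmoothAt R₂ p₂ := by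
  let S₁ := Localization.AtPrime p₁
  let S₂ := Localization.AtPrime p₂
  have hM := primeCompl_map_ringEquiv eA p₁ p₂ hp
  let e' : S₁ ≃+* S₂ :=
    IsLocalization.ringEquivOfRingEquiv (M := p₁.primeCompl) (T := p₂.primeCompl) S₁ S₂ eA hM
  -- `S₂` as an `R₁`-algebra through `eR`; `e'` is then an `R₁`-isomorphism
  letI : Algebra R₁ S₂ := ((algebraMap R₂ S₂).comp eR.toRingHom).toAlgebra
  have he' : ∀ r : R₁, e' (algebraMap R₁ S₁ r) = algebraMap R₁ S₂ r := fun r => by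
    rw [IsScalarTower.algebraMap_apply R₁ A₁ S₁, IsLocalization.ringEquivOfRingEquiv_eq, hcomm,
      ← IsScalarTower.algebraMap_apply R₂ A₂ S₂]
    rfl
  let f : S₁ ≃ₐ[R₁] S₂ := AlgEquiv.ofRingEquiv (f := e') he'
  haveI : Algebra.FormallySmooth R₁ S₁ := h
  haveI : Algebra.FormallySmooth R₁ S₂ := Algebra.FormallySmooth.of_equiv f
  exact formallySmooth_of_ringEquiv_base (A := S₂) eR fun _ => rfl

/-- `isSmoothAt_of_ringEquiv` over a fixed base. [folklore] -/
theorem isSmoothAt_of_algEquiv {R A₁ A₂ : Type*} [CommRing R] [CommRing A₁] [CommRing A₂]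
    [Algebra R A₁] [Algebra R A₂] (eA : A₁ ≃ₐ[R] A₂)
    (p₁ : Ideal A₁) (p₂ : Ideal A₂) [p₁.IsPrime] [p₂.IsPrime]
    (hp : p₁ = p₂.comap eA.toRingEquiv.toRingHom)
    (h : Algebra.IsSmoothAt R p₁) : Algebra.IsSmoothAt R p₂ :=
  isSmoothAt_of_ringEquiv (RingEquiv.refl R) eA.toRingEquiv (fun r => by simp) p₁ p₂ hp h

end smoothAt

/-! ### Units and the maximal ideal in an extension of valuation rings -/

section valuation

variable {K L : Type*} [Field K] [Field L]

/-- Membership in the maximal ideal of a valuation subring, in terms of the field. [folklore] -/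
theorem mem_maximalIdeal_valuationSubring_iff_or (O : ValuationSubring K) (x : O) :
    x ∈ IsLocalRing.maximalIdeal O ↔ (x : K) = 0 ∨ (x : K)⁻¹ ∉ O := by
  rw [IsLocalRing.mem_maximalIdeal, mem_nonunits_iff, Submonoid.isUnit_iff_and, not_and_or,
    not_not]

/-- **Centres contract along extensions of valued fields**: if `O′ ∩ K = O` (for a field map
`f : K → L`) then an element of `O` lies in `𝔪_O` iff its image lies in `𝔪_{O′}`. [folklore] -/
theorem mem_maximalIdeal_iff_of_comap_eq (f : K →+* L) (O : ValuationSubring K)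
    (O' : ValuationSubring L) (h : O'.comap f = O) (x : O) (hfx : f x ∈ O') :
    (⟨f x, hfx⟩ : O') ∈ IsLocalRing.maximalIdeal O' ↔ x ∈ IsLocalRing.maximalIdeal O := by
  rw [mem_maximalIdeal_valuationSubring_iff_or, mem_maximalIdeal_valuationSubring_iff_or]
  simp only [map_eq_zero]
  apply or_congr Iff.rfl
  rw [← map_inv₀, not_iff_not]
  change (x : K)⁻¹ ∈ O'.comap f ↔ _
  rw [h]

end valuation

end Literature.AlgebraicGeometry.Resolution
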